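import Mathlib
import Literature.Computability.AlgebraicComplexity.PermanentIrreducible
import Summits.ValiantsHypothesis.ValiantsHypothesis.Theses.ValuativeGCT

/-!
# Tangent rank of the permanent (B2)

Stub `stub_tangentRank` of line `skew-restriction-rank` for crux `ValuativeGCT.ValuativeFlip`
(stmt-ValiantsHypothesis-12624): `per_n ≠ 0` and `dim span{x_a ∂_b per_n : a, b} ≥ n⁴ - n²` for
`n ≥ 3`.  The off-diagonal sub-family `a ≠ b` is linearly independent: with
`x_a ∂_b per = ∑_{σ : σ b.2 = b.1} X ^ (e_a + μ_σ - e_b)` (`trExp`), row/column sums of an exponent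
determine the rows/columns of `a, b` where they differ (type S: private monomials); same-row
members share each monomial in pairs, so three rows force zero; columns by transposition.
-/

set_option linter.dupNamespace false

namespace Summit.ValiantsHypothesis.ValiantsHypothesis.Theorems.ValuativeFlip

open MvPolynomial Literature.NumberTheory.DiophantineGeometry
open Literature.Computability.AlgebraicComplexity

noncomputable section

variable {ι : Type*} [Fintype ι] [DecidableEq ι] (K : Type*) [Field K]

/-- The exponent of the `σ`-term of `X a * ∂_b per`: `e_a + μ_σ - e_b` (a notation, so that this
helper file introduces no definitions). -/
local notation:max "trExp[" σ ", " a ", " b "]" =>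
  (Finsupp.single a (1 : ℕ) + (permMonomial σ - Finsupp.single b (1 : ℕ)))

/-- The index type `{(a, b) : a ≠ b}` of the off-diagonal family `{X a * ∂_b per : a ≠ b}`. -/
local notation:max "TrIdx " ι:max => {p : (ι × ι) × (ι × ι) // Prod.fst p ≠ Prod.snd p}

/-- The number of terms of the member `q : TrIdx ι` of the family with exponent `d`. -/
local notation:max "trCnt[" q ", " d "]" =>
  Finset.card (Finset.univ.filter fun σ : Equiv.Perm _ =>
    σ (Prod.snd (Prod.snd (Subtype.val q))) = Prod.fst (Prod.snd (Subtype.val q)) ∧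
      trExp[σ, Prod.fst (Subtype.val q), Prod.snd (Subtype.val q)] = d)

/-- `μ_σ` has a `1` at every cell of `σ`. [folklore] -/
theorem tr_permMonomial_eq {σ : Equiv.Perm ι} (b : ι × ι) :
    permMonomial σ b = if σ b.2 = b.1 then 1 else 0 :=
  permMonomial_apply σ b.1 b.2

/-- The coefficients of `X a * ∂_b per = ∑_{σ : σ b.2 = b.1} X ^ (trExp[σ, a, b])` count
permutations. [folklore] -/
theorem tr_coeff_X_mul_pderiv_perPoly (a b : ι × ι) (d : ι × ι →₀ ℕ) :
    coeff d (X a * pderiv b (perPoly ι K)) =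
      ((Finset.univ.filter (fun σ : Equiv.Perm ι => σ b.2 = b.1 ∧ trExp[σ, a, b] = d)).card : K) := by
  rw [perPoly_eq_sum_monomial, map_sum, Finset.mul_sum, coeff_sum, ← Finset.filter_filter,
    ← Finset.sum_boole, Finset.sum_filter]
  refine Finset.sum_congr rfl fun σ _ => ?_
  rw [pderiv_monomial, one_mul, tr_permMonomial_eq]
  by_cases h : σ b.2 = b.1
  · rw [if_pos h, if_pos h, Nat.cast_one, X, monomial_mul, one_mul, coeff_monomial]
  · rw [if_neg h, if_neg h, Nat.cast_zero, monomial_zero, mul_zero, coeff_zero]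

/-- Pointwise values of `trExp[σ, a, b]` when `b` is a cell of `σ`. [folklore] -/
theorem trExp_apply {σ : Equiv.Perm ι} {b : ι × ι} (hσ : σ b.2 = b.1) (a x : ι × ι) :
    trExp[σ, a, b] x = (if x = a then 1 else 0) +
      (if x.2 = b.2 then 0 else if σ x.2 = x.1 then 1 else 0) := by
  obtain ⟨r, c⟩ := x
  obtain ⟨k, l⟩ := b
  simp only [Finsupp.coe_add, Pi.add_apply, Finsupp.single_apply, Finsupp.coe_tsub,
    Pi.sub_apply, permMonomial_apply, Prod.mk.injEq, @eq_comm _ a]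
  congr 1
  dsimp only at hσ
  by_cases hc : c = l
  · subst hc
    by_cases hr : r = k
    · simp [hr, hσ]
    · simp [hσ, Ne.symm hr]
  · simp [hc, Ne.symm hc]

/-- Row sums of a single cell. [folklore] -/
theorem tr_rowCount_single (a : ι × ι) (r : ι) :
    rowCount (Finsupp.single a 1) r = if r = a.1 then 1 else 0 := by
  obtain ⟨i, j⟩ := a
  simp only [rowCount, Finsupp.single_apply, Prod.mk.injEq]
  by_cases h : r = i
  · subst h
    simp
  · simp [Ne.symm h, h]

/-- Column sums of a single cell. [folklore] -/
theorem tr_colCount_single (a : ι × ι) (c : ι) :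
    colCount (Finsupp.single a 1) c = if c = a.2 then 1 else 0 := by
  obtain ⟨i, j⟩ := a
  simp only [colCount, Finsupp.single_apply, Prod.mk.injEq]
  by_cases h : c = j
  · subst h
    simp
  · simp [Ne.symm h, h]

/-- Row signature of `trExp[σ, a, b]`. [folklore] -/
theorem tr_rowCount_trExp {σ : Equiv.Perm ι} {b : ι × ι} (hσ : σ b.2 = b.1) (a : ι × ι) (r : ι) :
    rowCount (trExp[σ, a, b]) r + (if r = b.1 then 1 else 0) = (if r = a.1 then 1 else 0) + 1 := by
  have h1 := congr_arg (rowCount · r) (tsub_add_cancel_of_le (Finsupp.single_le_iff.2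
    (show 1 ≤ permMonomial σ b by rw [tr_permMonomial_eq, if_pos hσ])))
  simp only [rowCount_add, rowCount_permMonomial, tr_rowCount_single] at h1
  rw [rowCount_add, tr_rowCount_single]
  omega

/-- Column signature of `trExp[σ, a, b]`. [folklore] -/
theorem tr_colCount_trExp {σ : Equiv.Perm ι} {b : ι × ι} (hσ : σ b.2 = b.1) (a : ι × ι) (c : ι) :
    colCount (trExp[σ, a, b]) c + (if c = b.2 then 1 else 0) = (if c = a.2 then 1 else 0) + 1 := by
  have h1 := congr_arg (colCount · c) (tsub_add_cancel_of_le (Finsupp.single_le_iff.2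
    (show 1 ≤ permMonomial σ b by rw [tr_permMonomial_eq, if_pos hσ])))
  simp only [colCount_add, colCount_permMonomial, tr_colCount_single] at h1
  rw [colCount_add, tr_colCount_single]
  omega

omit [Fintype ι] in
/-- Signature logic: `[r = i] + [r = k'] = [r = i'] + [r = k]` for all `r`. [folklore] -/
theorem tr_sig {i k i' k' : ι} (h : ∀ r : ι, (if r = i then 1 else 0) + (if r = k' then 1 else 0) =
      ((if r = i' then 1 else 0) + (if r = k then 1 else 0) : ℕ)) :
    (i = k → i' = k') ∧ (i ≠ k → i = i' ∧ k = k') := by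
  refine ⟨fun hik => ?_, fun hik => ⟨?_, ?_⟩⟩ <;> by_contra hne
  · subst hik
    have h1 := h k'
    rw [if_pos rfl, if_neg (Ne.symm hne)] at h1
    omega
  · have h1 := h i
    rw [if_pos rfl, if_neg hne, if_neg hik] at h1
    omega
  · have h1 := h k
    rw [if_pos rfl, if_neg (Ne.symm hik), if_neg hne] at h1
    omega

/-- The row and column signatures of equal exponent vectors agree. [folklore] -/
theorem tr_sig_of_trExp_eq {σ σ' : Equiv.Perm ι} {a b a' b' : ι × ι}
    (hσ : σ b.2 = b.1) (hσ' : σ' b'.2 = b'.1) (h : trExp[σ', a', b'] = trExp[σ, a, b]) :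
    (∀ r : ι, (if r = a.1 then 1 else 0) + (if r = b'.1 then 1 else 0) =
      ((if r = a'.1 then 1 else 0) + (if r = b.1 then 1 else 0) : ℕ)) ∧
    (∀ c : ι, (if c = a.2 then 1 else 0) + (if c = b'.2 then 1 else 0) =
      ((if c = a'.2 then 1 else 0) + (if c = b.2 then 1 else 0) : ℕ)) := by
  refine ⟨fun r => ?_, fun c => ?_⟩
  · have e1 := tr_rowCount_trExp hσ a r
    have e2 := tr_rowCount_trExp hσ' a' r
    rw [h] at e2
    omega
  · have e1 := tr_colCount_trExp hσ a c
    have e2 := tr_colCount_trExp hσ' a' c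
    rw [h] at e2
    omega

/-- A term of `X a * ∂_b per` determines its permutation. [folklore] -/
theorem tr_perm_eq_of_trExp_eq {σ σ' : Equiv.Perm ι} {a b : ι × ι} (hσ : σ b.2 = b.1)
    (hσ' : σ' b.2 = b.1) (h : trExp[σ', a, b] = trExp[σ, a, b]) : σ' = σ := by
  ext c
  by_cases hc : c = b.2
  · rw [hc, hσ, hσ']
  · have h1 := DFunLike.congr_fun h (σ' c, c)
    rw [trExp_apply hσ', trExp_apply hσ] at h1
    dsimp only at h1
    rw [if_neg hc, if_neg hc, if_pos rfl] at h1
    by_contra h2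
    rw [if_neg (Ne.symm h2)] at h1
    omega

/-- Type S (`a.1 ≠ b.1`, `a.2 ≠ b.2`): every monomial of `X a * ∂_b per` is private. [folklore] -/
theorem tr_S_unique {σ σ' : Equiv.Perm ι} {a b a' b' : ι × ι} (h1 : a.1 ≠ b.1) (h2 : a.2 ≠ b.2)
    (hσ : σ b.2 = b.1) (hσ' : σ' b'.2 = b'.1) (h : trExp[σ', a', b'] = trExp[σ, a, b]) :
    a' = a ∧ b' = b ∧ σ' = σ := by
  obtain ⟨hrow, hcol⟩ := tr_sig_of_trExp_eq hσ hσ' h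
  obtain ⟨ha1, hb1⟩ := (tr_sig hrow).2 h1
  obtain ⟨ha2, hb2⟩ := (tr_sig hcol).2 h2
  obtain ⟨⟩ : a' = a := Prod.ext ha1.symm ha2.symm
  obtain ⟨⟩ : b' = b := Prod.ext hb1.symm hb2.symm
  exact ⟨rfl, rfl, tr_perm_eq_of_trExp_eq hσ hσ' h⟩

/-- Type T (`a.1 = b.1`, `a.2 ≠ b.2`): a shared monomial comes from the same-row family. [folklore] -/
theorem tr_T_classify {σ σ' : Equiv.Perm ι} {a b a' b' : ι × ι} (h1 : a.1 = b.1) (h2 : a.2 ≠ b.2)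
    (hσ : σ b.2 = b.1) (hσ' : σ' b'.2 = b'.1) (h : trExp[σ', a', b'] = trExp[σ, a, b]) :
    a'.1 = b'.1 ∧ a'.2 = a.2 ∧ b'.2 = b.2 := by
  obtain ⟨hrow, hcol⟩ := tr_sig_of_trExp_eq hσ hσ' h
  obtain ⟨ha2, hb2⟩ := (tr_sig hcol).2 h2
  exact ⟨(tr_sig hrow).1 h1, ha2.symm, hb2.symm⟩

/-- Type T: the monomial of `(σ, (r,j), (r,l))`, `σ l = r`, `σ j = s`, lives in rows `r`, `s` only. [folklore] -/
theorem tr_T_rows {σ σ' : Equiv.Perm ι} {j l r s t : ι} (hjl : j ≠ l) (hσl : σ l = r)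
    (hσj : σ j = s) (hσ' : σ' l = t) (h : trExp[σ', (t, j), (t, l)] = trExp[σ, (r, j), (r, l)]) :
    t = r ∨ t = s := by
  have hσ'j : σ' j ≠ t := fun h' => hjl (σ'.injective (h'.trans hσ'.symm))
  have e1 := DFunLike.congr_fun h (t, j)
  rw [trExp_apply (b := (t, l)) hσ', trExp_apply (b := (r, l)) hσl] at e1
  simp only [Prod.mk.injEq, and_true, if_true, hjl, if_false, hσ'j, hσj] at e1
  by_contra hh
  rw [if_neg (fun h' => hh (Or.inl h')), if_neg (fun h' => hh (Or.inr h'.symm))] at e1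
  omega

/-- Type T, the partner: the swapped permutation realises the same monomial in row `s`. [folklore] -/
theorem tr_T_swap_trExp {σ : Equiv.Perm ι} {j l r s : ι} (hjl : j ≠ l) (hσl : σ l = r)
    (hσj : σ j = s) : trExp[σ * Equiv.swap j l, (s, j), (s, l)] = trExp[σ, (r, j), (r, l)] := by
  have hτ : (σ * Equiv.swap j l) (s, l).2 = (s, l).1 := by
    simp only [Equiv.Perm.mul_apply, Equiv.swap_apply_right, hσj]
  ext ⟨ρ, c⟩
  rw [trExp_apply hτ, trExp_apply (b := (r, l)) hσl]
  simp only [Equiv.Perm.mul_apply, Prod.mk.injEq]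
  by_cases hcj : c = j
  · subst hcj
    simp only [Equiv.swap_apply_left, hσl, hσj, and_true, hjl, if_false, @eq_comm _ r ρ,
      @eq_comm _ s ρ]
    exact add_comm _ _
  · by_cases hcl : c = l
    · subst hcl
      simp [hcj]
    · simp [Equiv.swap_apply_of_ne_of_ne hcj hcl, hcj, hcl]

/-- Three distinct indices from `3 ≤ |ι|`. [folklore] -/
theorem tr_exists_three (h3 : 3 ≤ Fintype.card ι) (r : ι) : ∃ s u : ι, s ≠ r ∧ u ≠ r ∧ s ≠ u := by
  have h : 1 < (Finset.univ.erase r).card := by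
    rw [Finset.card_erase_of_mem (Finset.mem_univ r), Finset.card_univ]
    omega
  obtain ⟨s, hs, u, hu, hsu⟩ := Finset.one_lt_card.1 h
  exact ⟨s, u, (Finset.mem_erase.1 hs).1, (Finset.mem_erase.1 hu).1, hsu⟩

omit [Fintype ι] in
/-- A permutation with two prescribed values. [folklore] -/
theorem tr_exists_perm {j l r s : ι} (hjl : j ≠ l) (hrs : r ≠ s) :
    ∃ σ : Equiv.Perm ι, σ l = r ∧ σ j = s := by
  have hne : Equiv.swap l r j ≠ r := fun h =>
    hjl ((Equiv.swap l r).injective (h.trans (Equiv.swap_apply_left l r).symm))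
  refine ⟨Equiv.swap (Equiv.swap l r j) s * Equiv.swap l r, ?_, ?_⟩
  · rw [Equiv.Perm.mul_apply, Equiv.swap_apply_left, Equiv.swap_apply_of_ne_of_ne hne.symm hrs]
  · rw [Equiv.Perm.mul_apply, Equiv.swap_apply_left]

/-- `|{(a, b) : a ≠ b}| = n⁴ - n²` for `n = |ι|`. [folklore] -/
theorem tr_card_TrIdx : Fintype.card (TrIdx ι) = Fintype.card ι ^ 4 - Fintype.card ι ^ 2 := by
  rw [Fintype.card_subtype, show (Finset.univ.filter fun p : (ι × ι) × (ι × ι) => p.1 ≠ p.2) =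
    (Finset.univ : Finset (ι × ι)).offDiag by ext; simp, Finset.offDiag_card, Finset.card_univ,
    Fintype.card_prod, show Fintype.card ι ^ 4 = _ * _ * (_ * _) by ring, sq]

/-- Coefficient extraction from a vanishing combination of the `X a * ∂_b per`. [folklore] -/
theorem tr_coeff_rel {g : TrIdx ι → K}
    (hg : ∑ p : TrIdx ι, g p • (X p.1.1 * pderiv p.1.2 (perPoly ι K)) = 0) (d : ι × ι →₀ ℕ) :
    ∑ p : TrIdx ι, g p * (trCnt[p, d] : K) = 0 := by
  simpa only [coeff_sum, coeff_smul, smul_eq_mul, coeff_zero, tr_coeff_X_mul_pderiv_perPoly]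
    using congr_arg (coeff d) hg

/-- A filter with exactly one solution has cardinality `1`. [folklore] -/
theorem tr_card_one {P : Equiv.Perm ι → Prop} [DecidablePred P] {σ₀ : Equiv.Perm ι} (h0 : P σ₀)
    (h : ∀ σ, P σ → σ = σ₀) : ((Finset.univ.filter P).card : K) = 1 := by
  rw [show Finset.univ.filter P = {σ₀} from Finset.eq_singleton_iff_unique_mem.2
    ⟨by simpa using h0, fun σ hσ => h σ (by simpa using hσ)⟩, Finset.card_singleton, Nat.cast_one]

/-- A filter with no solution has cardinality `0`. [folklore] -/
theorem tr_card_zero {P : Equiv.Perm ι → Prop} [DecidablePred P] (h : ∀ σ, ¬P σ) :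
    ((Finset.univ.filter P).card : K) = 0 := by
  rw [Finset.filter_false_of_mem fun σ _ => h σ, Finset.card_empty, Nat.cast_zero]

/-- Step S: coefficients of type-S members (`a.1 ≠ b.1`, `a.2 ≠ b.2`) vanish. [folklore] -/
theorem tr_S_of_rel {g : TrIdx ι → K}
    (hg : ∑ p : TrIdx ι, g p • (X p.1.1 * pderiv p.1.2 (perPoly ι K)) = 0)
    (p : TrIdx ι) (h1 : p.1.1.1 ≠ p.1.2.1) (h2 : p.1.1.2 ≠ p.1.2.2) : g p = 0 := by
  have hσ₀ : Equiv.swap p.1.2.2 p.1.2.1 p.1.2.2 = p.1.2.1 := Equiv.swap_apply_left _ _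
  have key : ∀ q : TrIdx ι, (trCnt[q, trExp[Equiv.swap p.1.2.2 p.1.2.1, p.1.1, p.1.2]] : K) =
      if q = p then 1 else 0 := by
    intro q
    by_cases hq : q = p
    · rw [if_pos hq, hq]
      exact tr_card_one K ⟨hσ₀, rfl⟩ fun σ h => tr_perm_eq_of_trExp_eq hσ₀ h.1 h.2
    · rw [if_neg hq]
      refine tr_card_zero K fun σ h => hq ?_
      obtain ⟨ha, hb, -⟩ := tr_S_unique h1 h2 hσ₀ h.1 h.2
      exact Subtype.ext (Prod.ext ha hb)
  simpa [key] using tr_coeff_rel K hg (trExp[Equiv.swap p.1.2.2 p.1.2.1, p.1.1, p.1.2])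

/-- Step T: coefficients of same-row members vanish (rows pair up; three rows). [folklore] -/
theorem tr_T_of_rel [CharZero K] (h3 : 3 ≤ Fintype.card ι) {g : TrIdx ι → K}
    (hg : ∑ p : TrIdx ι, g p • (X p.1.1 * pderiv p.1.2 (perPoly ι K)) = 0)
    (p : TrIdx ι) (h1 : p.1.1.1 = p.1.2.1) : g p = 0 := by
  have h2 : p.1.1.2 ≠ p.1.2.2 := fun h2 => p.2 (Prod.ext h1 h2)
  set j := p.1.1.2
  set l := p.1.2.2
  let G : ι → TrIdx ι := fun t => ⟨((t, j), (t, l)), fun h => h2 (Prod.mk.inj h).2⟩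
  have hGinj : ∀ {r s : ι}, G r = G s → r = s := fun h => congr_arg (fun q : TrIdx ι => q.1.1.1) h
  have hpair : ∀ r s : ι, r ≠ s → g (G r) + g (G s) = 0 := by
    intro r s hrs
    obtain ⟨σ, hσl, hσj⟩ := tr_exists_perm h2 hrs
    have hτ : (σ * Equiv.swap j l) l = s := by
      rw [Equiv.Perm.mul_apply, Equiv.swap_apply_right, hσj]
    have hsw := tr_T_swap_trExp h2 hσl hσj
    have key : ∀ q : TrIdx ι, (trCnt[q, trExp[σ, (r, j), (r, l)]] : K) =
        (if q = G r then 1 else 0) + (if q = G s then 1 else 0) := by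
      intro q
      by_cases hqr : q = G r
      · subst hqr
        rw [if_pos rfl, if_neg (fun h => hrs (hGinj h)), add_zero]
        exact tr_card_one K ⟨hσl, rfl⟩ fun σ' h => tr_perm_eq_of_trExp_eq (b := (r, l)) hσl h.1 h.2
      by_cases hqs : q = G s
      · subst hqs
        rw [if_neg hqr, if_pos rfl, zero_add]
        exact tr_card_one K ⟨hτ, hsw⟩ fun σ' h =>
          tr_perm_eq_of_trExp_eq (b := (s, l)) hτ h.1 (h.2.trans hsw.symm)
      rw [if_neg hqr, if_neg hqs, add_zero]
      refine tr_card_zero K fun σ' h => ?_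
      obtain ⟨hq1, hq2, hq3⟩ := tr_T_classify (a := (r, j)) (b := (r, l)) rfl h2 hσl h.1 h.2
      have hqG : q = G q.1.1.1 := Subtype.ext (Prod.ext (Prod.ext rfl hq2) (Prod.ext hq1.symm hq3))
      obtain ⟨h5, h6⟩ := h
      rw [hq3, ← hq1] at h5
      rw [hqG] at h6
      rcases tr_T_rows h2 hσl hσj h5 h6 with htr | hts
      · exact hqr (hqG.trans (by rw [htr]))
      · exact hqs (hqG.trans (by rw [hts]))
    simpa [key, mul_add, Finset.sum_add_distrib] using tr_coeff_rel K hg (trExp[σ, (r, j), (r, l)])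
  obtain ⟨s, u, hsr, hur, hsu⟩ := tr_exists_three h3 p.1.1.1
  have e1 := hpair _ _ hsr.symm
  have e2 := hpair _ _ hsu
  have e3 := hpair _ _ hur.symm
  have h2g : (2 : K) * g (G p.1.1.1) = 0 := by linear_combination e1 - e2 + e3
  rw [show p = G p.1.1.1 from Subtype.ext (Prod.ext (Prod.ext rfl rfl) (Prod.ext h1.symm rfl))]
  exact (mul_eq_zero.mp h2g).resolve_left two_ne_zero

/-- The generic permanent is symmetric: `per(Xᵀ) = per(X)`. [folklore] -/
theorem tr_rename_swap_perPoly : rename Prod.swap (perPoly ι K) = perPoly ι K := by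
  have h : rename (Prod.swap : ι × ι → ι × ι) (perPoly ι K) =
      ((Matrix.mvPolynomialX ι ι K).transpose).permanent := by
    simp [perPoly, Matrix.permanent, map_sum, map_prod, Matrix.mvPolynomialX, rename_X]
  rw [h, Matrix.permanent_transpose]
  rfl

/-- A vanishing combination stays vanishing after transposing all indices. [folklore] -/
theorem tr_rel_swap {g : TrIdx ι → K}
    (hg : ∑ p : TrIdx ι, g p • (X p.1.1 * pderiv p.1.2 (perPoly ι K)) = 0) :
    ∑ p : TrIdx ι, g ⟨(p.1.1.swap, p.1.2.swap), fun h => p.2 (Prod.swap_injective h)⟩ •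
      (X p.1.1 * pderiv p.1.2 (perPoly ι K)) = 0 := by
  have h := congr_arg (rename (Prod.swap : ι × ι → ι × ι)) hg
  rw [map_sum, map_zero] at h
  simp only [map_smul, map_mul, rename_X, ← pderiv_rename Prod.swap_injective,
    tr_rename_swap_perPoly] at h
  have hθ : Function.Involutive fun p : TrIdx ι =>
      (⟨(p.1.1.swap, p.1.2.swap), fun h => p.2 (Prod.swap_injective h)⟩ : TrIdx ι) := fun p => by
    ext <;> rfl
  rw [← hθ.bijective.sum_comp]
  convert h using 2 with p
  simp only [Prod.swap_swap]

/-- **Linear independence of the off-diagonal tangent vectors of the permanent**: for `|ι| ≥ 3`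
the `|ι|⁴ - |ι|²` polynomials `X a * ∂_b per_ι`, `a ≠ b`, are linearly independent. [folklore] -/
theorem tr_linearIndependent [CharZero K] (h3 : 3 ≤ Fintype.card ι) :
    LinearIndependent K (fun p : TrIdx ι => X p.1.1 * pderiv p.1.2 (perPoly ι K)) := by
  rw [Fintype.linearIndependent_iff]
  intro g hg p
  by_cases h1 : p.1.1.1 = p.1.2.1
  · exact tr_T_of_rel K h3 hg p h1
  by_cases h2 : p.1.1.2 = p.1.2.2
  · simpa using tr_T_of_rel K h3 (tr_rel_swap K hg)
      ⟨(p.1.1.swap, p.1.2.swap), fun h => p.2 (Prod.swap_injective h)⟩ h2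
  · exact tr_S_of_rel K hg p h1 h2

/-- **B2, tangent rank of the permanent.** `paddedPerFormLex ℂ n n = per_n ≠ 0` (in the
lexicographically ordered matrix variables) and, for `n ≥ 3`, the tangent space
`span{x_a ∂_b per_n : a, b ∈ MatIdx n}` of its `GL_{n²}`-orbit has dimension at least `n⁴ - n²`:
the off-diagonal sub-family `a ≠ b` is linearly independent (`tr_linearIndependent`: row/column
signatures make type-S monomials private, and same-row/same-column members pair up so that
three rows force vanishing in characteristic `0`), transported along the injective renaming
`BlockIdx n n × BlockIdx n n ↪ MatIdx n`. (`n = 2` fails: `per₂ ≅ det₂`.) [folklore] -/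
theorem stub_tangentRank (n : ℕ) [NeZero n] (hn : 3 ≤ n) :
    paddedPerFormLex ℂ n n ≠ 0 ∧
      n ^ 4 - n ^ 2 ≤ Module.finrank ℂ ↥(Submodule.span ℂ (Set.range fun ab : MatIdx n × MatIdx n =>
        MvPolynomial.X ab.1 * MvPolynomial.pderiv ab.2 (paddedPerFormLex ℂ n n))) := by
  set ι := BlockIdx n n
  let e : ι × ι → MatIdx n := fun ij => toLex ((ij.1 : Fin n), (ij.2 : Fin n))
  have he : Function.Injective e := fun x y h => Prod.ext
    (Subtype.ext (congr_arg (fun z => (ofLex z).1) h)) (Subtype.ext (congr_arg (fun z => (ofLex z).2) h))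
  have hpad : paddedPerFormLex ℂ n n = rename e (perPoly ι ℂ) := by
    simp only [paddedPerFormLex, paddedPerPoly, Nat.sub_self, pow_zero, one_mul, rename_rename]
    rfl
  have hcard : Fintype.card ι = n := card_blockIdx le_rfl
  refine ⟨fun h0 => ?_, ?_⟩
  · have h1 := coeff_permMonomial_perPoly ℂ (1 : Equiv.Perm ι)
    rw [hpad, ← map_zero (rename e)] at h0
    rw [rename_injective e he h0, coeff_zero] at h1
    exact zero_ne_one h1
  · set F : MatIdx n × MatIdx n → MvPolynomial (MatIdx n) ℂ := fun ab =>
      MvPolynomial.X ab.1 * MvPolynomial.pderiv ab.2 (paddedPerFormLex ℂ n n) with hF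
    have hli : LinearIndependent ℂ (fun p : TrIdx ι => F (e p.1.1, e p.1.2)) := by
      rw [show (fun p : TrIdx ι => F (e p.1.1, e p.1.2)) = (rename e).toLinearMap ∘
        (fun p : TrIdx ι => X p.1.1 * pderiv p.1.2 (perPoly ι ℂ)) from funext fun p => by
          simp only [Function.comp_apply, AlgHom.toLinearMap_apply, hF, hpad, map_mul, rename_X,
            pderiv_rename he]]
      exact (tr_linearIndependent ℂ (by omega)).map' _
        (LinearMap.ker_eq_bot.mpr (rename_injective e he))
    have h1 := finrank_span_eq_card hli
    rw [tr_card_TrIdx, hcard] at h1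
    haveI : Module.Finite ℂ (Submodule.span ℂ (Set.range F)) :=
      Module.Finite.span_of_finite ℂ (Set.finite_range F)
    exact h1 ▸ Submodule.finrank_mono (Submodule.span_mono
      (Set.range_subset_iff.2 fun p => ⟨(e p.1.1, e p.1.2), rfl⟩))

end

end Summit.ValiantsHypothesis.ValiantsHypothesis.Theorems.ValuativeFlip
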